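import Literature.MathematicalPhysics.QuantumFieldTheory.Balaban1983to89.FlowStep

/-!
# CRIT-1 g31 — CUT-1 follow-up on lens-2 v3.9 §15 («flat stub grammar»): the load-bearing readout stub is
# IMPLIED BY THE TARGET BOX at junk constants (A' = 0, σ₁ = β′ + B); row e flat is implied by mere boundedness (ρ = 0).

Critic's kernel (refuter-ym-nodeO-crit-1-g31-0, NODE O cover cell, 2026-08-30).  §1 copies lens-2's v3.9 definitions
`StepContractionFlat`, `ReadoutFlat`, `Cap` VERBATIM (file `nodeO-cover/LENS-2-Sketch-v3.lean` sha16 16947b59001c8a0c, :142, :1109, :1113;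
author planner-ymgap-nodeO-lens-2-g0-0); §2 proves the two junk implications.  Consequence: in `record13SepCoPHInhabited_of_lineRows`
(:1184) the stub `hr` (constants `A' σ₁ a₀'` existential AFTER the radius, only `0 ≤ ·` required) is the conclusion's β-box REWORDED WITH
SLACK (given `Cap`), and `he`∕`hb` then carry no load — №404 (a) fails for the grammar AS TYPED.  Nothing of Bałaban is asserted.
-/

namespace Summit.QuantumFields.YangMills.Cruxes.Record13SepCoPHInhabited.Crit1Cut1Lens2FlatJunk

open Literature.MathematicalPhysics.QuantumFieldTheory.Balaban1983to89.FlowStep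

/-! ## §1  lens-2 v3.9 definitions, verbatim -/

abbrev HSize : Type := (k : ℕ) → (Fin (k + 1) → ℝ) → ℝ

def Cap (b : ℕ → ℝ) (B : ℝ) : Prop := ∀ k, |b k| ≤ B

def StepContractionFlat (γbar : ℝ) (e : HSize) (ρ σ₀ b₁ : ℝ) : Prop :=
  ∀ (k : ℕ) (v : Fin (k + 2) → ℝ), v ∈ Box γbar (k + 1) → e (k + 1) v ≤ ρ * e k (Fin.init v) + σ₀ + v (Fin.last (k + 1)) * b₁

def ReadoutFlat (γbar : ℝ) (β : HBeta) (b : ℕ → ℝ) (e : HSize) (A' σ₁ a₀ : ℝ) : Prop :=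
  (∀ v : Fin 1 → ℝ, v ∈ Box γbar 0 → |β 0 v - b 0| ≤ σ₁ + v 0 * a₀) ∧
    ∀ (k : ℕ) (v : Fin (k + 2) → ℝ), v ∈ Box γbar (k + 1) →
      |β (k + 1) v - b (k + 1)| ≤ A' * e k (Fin.init v) + σ₁ + v (Fin.last (k + 1)) * a₀

/-! ## §2  The junk implications -/

/-- **THE READOUT STUB IS THE BOX REWORDED (given the cap):** if `β` is boxed by `β′` on the `γ`-boxes and `|b k| ≤ B`, then
`ReadoutFlat γ β b e A' σ₁ a₀` holds with the junk constants `A' = 0`, `σ₁ = β′ + B`, `a₀ = 0` — for EVERY size functional `e`. -/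
theorem readoutFlat_of_absBox {γ β' B : ℝ} {β : HBeta} {b : ℕ → ℝ} (e : HSize)
    (hlo : BetaLowerH (-β') γ β) (hup : BetaUpperH β' γ β) (hcap : Cap b B) :
    ReadoutFlat γ β b e 0 (β' + B) 0 := by
  have key : ∀ (k : ℕ) (v : Fin (k + 1) → ℝ), v ∈ Box γ k → |β k v - b k| ≤ β' + B := by
    intro k v hv
    have h1 : |β k v| ≤ β' := abs_le.mpr ⟨hlo k v hv, hup k v hv⟩
    calc |β k v - b k| ≤ |β k v| + |b k| := abs_sub _ _
      _ ≤ β' + B := add_le_add h1 (hcap k)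
  refine ⟨fun v hv => ?_, fun k v hv => ?_⟩
  · simpa using key 0 v hv
  · simpa using key (k + 1) v hv

/-- So the existential form used by the line's stub `hr` (`∃ A' σ₁ a₀', 0 ≤ A' ∧ 0 ≤ σ₁ ∧ 0 ≤ a₀' ∧ ReadoutFlat …`) follows from the box
and the cap alone (`β′, B ≥ 0` for the sign conditions). -/
theorem exists_readoutFlat_of_absBox {γ β' B : ℝ} {β : HBeta} {b : ℕ → ℝ} (e : HSize) (hβ' : 0 ≤ β') (hB : 0 ≤ B)
    (hlo : BetaLowerH (-β') γ β) (hup : BetaUpperH β' γ β) (hcap : Cap b B) :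
    ∃ A' σ₁ a₀' : ℝ, 0 ≤ A' ∧ 0 ≤ σ₁ ∧ 0 ≤ a₀' ∧ ReadoutFlat γ β b e A' σ₁ a₀' :=
  ⟨0, β' + B, 0, le_rfl, add_nonneg hβ' hB, le_rfl, readoutFlat_of_absBox e hlo hup hcap⟩

/-- **ROW e FLAT IS MERE BOUNDEDNESS:** a size functional bounded by `S ≥ 0` on the boxes satisfies `StepContractionFlat` with the junk
rate `ρ = 0` (so the Engine-C rate ρ̂ has no purchase on the stub as typed). -/
theorem stepContractionFlat_of_bounded {γ S : ℝ} {e : HSize}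
    (hS : ∀ (k : ℕ) (v : Fin (k + 2) → ℝ), v ∈ Box γ (k + 1) → e (k + 1) v ≤ S) :
    StepContractionFlat γ e 0 S 0 := by
  intro k v hv
  simpa using hS k v hv

/-- Conversely the flat row forces nothing beyond a bound growing at most linearly in nothing: with `ρ = 0` it IS the bound. -/
theorem bounded_of_stepContractionFlat_zero {γ S : ℝ} {e : HSize} (h : StepContractionFlat γ e 0 S 0) :
    ∀ (k : ℕ) (v : Fin (k + 2) → ℝ), v ∈ Box γ (k + 1) → e (k + 1) v ≤ S := by
  intro k v hv
  simpa using h k v hv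

end Summit.QuantumFields.YangMills.Cruxes.Record13SepCoPHInhabited.Crit1Cut1Lens2FlatJunk
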